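/-
Copyright: lit-balaban Phase-2 proof seat p33 (gen 4).  Statement-level skeleton of a published paper; no proof claims beyond what
the kernel checks below.
-/
import Literature.MathematicalPhysics.QuantumFieldTheory.BalabanImbrieJaffe1984to88.BIJ85SigmaGaugeInvariance
import Literature.MathematicalPhysics.QuantumFieldTheory.BalabanImbrieJaffe1984to88.BIJ85NoZeroModes309TorusPart2
import Literature.MathematicalPhysics.QuantumFieldTheory.BalabanImbrieJaffe1984to88.BIJ85SigmaPositivity

/-!
# `BalabanImbrieJaffe1984to88.BIJ85SigmaVariational` — T. Bałaban, J. Imbrie, A. Jaffe, *Renormalization of the Higgs model: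
minimizers, propagators and the stability of mean field theory*, Commun. Math. Phys. **97** (1985) 299–329 [BalabanImbrieJaffe1985]:
**THE VARIATIONAL READING OF (4.2.1)/(4.2.6)–(4.2.7)** — `⟨f, σ_kf⟩ = ‖f_k‖²` with `f_k` the component of `Q^{e*}_kf` orthogonal to
the curls of constraint fields IS the MINIMUM of the exponent `‖∂A − Q^{e*}_kf‖²` of (4.2.1) over the support of `δ(Q_kA)δ_{k,Ax}(A)`,
and ON THE TORI the axial-gauge factor `δ_{k,Ax}` may be DROPPED from that minimum (gauge invariance, as used on p. 322); hence
**Theorem 7.1.1 for the torus σ_k ⟺ the configuration-space variational bound `c‖f‖² ≤ ‖∂A − Q^{e*}_kf‖²_η` for all `A` with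
`Q_kA = 0`**

statement-level skeleton of published theorems with citation tags; proofs where landed; nothing here is a claim about the Yang–Mills mass gap

PDF held: `paper:balaban1985-cmp97-bij-higgs-minimizers` (journal page = PDF page + 298).  Pages read as images: p. 310–311 [PDF 12–13]
(`run/shared/lean/pub/pub-balaban/t4/b2b-balaban-t4-lit2/renders/bij1985/1985-cmp97-bij-higgs-minimizers-p012-x2.png`, `…-p013-x2.png`),
p. 321–322, 324 [PDF 23–24, 26].

CITATION HEADER (lean-in-tree rule).  Part of the lit-balaban TYPED SKELETON (HOME `run/shared/lean/pub/lit-balaban/`), Phase-2 seat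
p33 (gen 4), unit `lit-balaban-p33`; rows **C1.Eq4.2.1-4.2.2**, **C1.Eq4.2.3** and **C1.Thm7.1.1** of `HOME/SKELETON.md` (owner r15, referee
ref-5) — companion of seat p09's `BIJ85SigmaForm421` (σ_k (4.2.2) satisfies (4.2.1); `∂G_{k,Ax}∂^*` is the orthogonal projection onto
`∂V`: `curlG_symm`, `curlG_idem`, `curlG_apply_curl`, `curlG_mem_range`, `inner_sigmaOp_eq_norm_sq`), of seat p30's `BIJ85Sigma421Torus`
(`sigmaTorus`), of this seat's `BIJ85NoZeroModes309Torus` (gen 2: no zero modes, `noZeroModes_V411_holds`) and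
`BIJ85SigmaGaugeInvariance` (gen 3: *"the gauge chosen to define σ_k is irrelevant"*; the k-axial gauge is ACCESSIBLE inside
`δ(Q_kA)`, `exists_mem_V411_curlOp_eq`), and of seat p27 gen 5's `BIJ85Eq7112FibreEnergy`, whose header records the target shape
*"Theorem 7.1.1 in configuration space in the variational form `c‖f‖² ≤ ‖∂A − Q^{e*}_kf‖²_η ∀ Q_kA = 0`"* and, under NOT CLAIMED,
*"the axial gauge δ_{k,Ax} (by gauge invariance of ‖∂A − Q^{e*}_kf‖² and of Q_kA under A ↦ A − ∂^ηλ, Q′_kλ = 0, it does not change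
the infimum — not formalised here)"* — formalised HERE, on the `Setup` carriers of seats p09/p30 (`V411 P k`, `curlOp w c = √w·∂`,
`QesOp hd w k = √w·Q^{e*}_k`, `w = η^d`).

THE PRINTED TEXT (verbatim).  p. 310 [PDF 12]: *"exp(−½⟨f, σ_kf⟩) = Z_{k,Ax}^{−1}∫𝒟Aδ(Q_kA)δ_{k,Ax}(A)exp(−½‖∂A − Q^{e*}_kf‖²).
(4.2.1) … The right side of (4.2.2) involves the combination ∂G_{k,Ax}∂^* which is invariant under a change of gauge. Hence the
gauge chosen to define σ_k is irrelevant, and the quadratic form σ_k is gauge invariant. We use this property in Sect. 7 when we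
derive an explicit momentum-space representation for σ_k. Using that representation we also establish a uniform, positive lower
bound 0 < c ≤ σ_k. (4.2.3) … f_k = (I − ∂G_{k,Ax}∂^*)Q^{e*}_kf^{(k)}. (4.2.6) … ½⟨f^{(k)}, σ_kf^{(k)}⟩ = ½‖f_k‖². (4.2.7)"*; p. 311
[PDF 13]: *"This identity is a consequence of the fact that ∂G_{k,Ax}∂^* is a projection operator."*; p. 322 [PDF 24]: *"The axial
gauge Green's function G_{k,Ax} has a very complicated momentum space structure. Thus we use gauge invariance of ∂G_{k,Ax}∂^* to
replace it by the Landau gauge operator ∂G_k∂^*."*; p. 321 [PDF 23]: *"Theorem 7.1.1. There exists a constant c > 0, independent of k,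
such that c ≤ σ_k. (7.1.1)"*.  (The infimum formulation itself is not a display of the paper: it is the elementary content of (4.2.7)
with the projection property — `‖f_k‖` is the distance from `Q^{e*}_kf` to the space `∂V` of curls of constraint fields — recorded here
because it is the form in which Sect. 7's momentum-space argument, and seat p27's fibre decomposition, address σ_k.)

WHAT IS PROVED (theorems only; D-0026: no new `def`, no new named fact).
* §1 ABSTRACT (p09's Euclidean setting `E, F, F′`, constraint subspace `V`, curl `D` without zero modes on `V`, `Qes = Q^{e*}_k`):
  Pythagoras for the projection `∂G_{k,Ax}∂^*` (`norm_sub_curl_sq`), the energy identity `‖∂v − Q^{e*}_kf‖² = ⟨f, σ_kf⟩ +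
  ‖∂G_{k,Ax}∂^*Q^{e*}_kf − ∂v‖²` (`energy_eq`), hence **`⟨f, σ_kf⟩ ≤ ‖∂v − Q^{e*}_kf‖²` for every `v ∈ V` with EQUALITY ATTAINED**
  (`inner_sigmaOp_le_energy`, `exists_energy_eq_inner_sigmaOp`), **`⟨f, σ_kf⟩ = inf_{v∈V}‖∂v − Q^{e*}_kf‖²`** (`inner_sigmaOp_eq_iInf`)
  and the transfer of lower bounds `a ≤ ⟨f, σ_kf⟩ ↔ ∀ v ∈ V, a ≤ ‖∂v − Q^{e*}_kf‖²` (`le_inner_sigmaOp_iff`);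
* §2 ON THE TORI (`sigmaTorus hd w c k`, standing range `k ≤ m + K`, `w > 0`, `c ≠ 0`, `2 ≤ d`): **the factor `δ_{k,Ax}` REMOVED** —
  `⟨f, σ_kf⟩ ≤ ‖√w·∂A − √w·Q^{e*}_kf‖² = Σ_pη^d|(∂A)(p) − (Q^{e*}_kf)(p)|²` for EVERY η-bond field `A` with `Q_kA = 0`, axial or not
  (`inner_sigmaTorus_le_energy`, `inner_sigmaTorus_le_energy_sum`; gen 3's accessibility of the axial gauge inside `N(Q′_k)`), equality
  attained inside `δ(Q_kA)δ_{k,Ax}` (`exists_energy_eq_inner_sigmaTorus`), **`⟨f, σ_kf⟩ = inf_{Q_kA = 0}‖∂A − Q^{e*}_kf‖²_η =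
  inf_{Q_kA=0, δ_{k,Ax}(A)}‖∂A − Q^{e*}_kf‖²_η`** (`inner_sigmaTorus_eq_iInf`, `inner_sigmaTorus_eq_iInf_axial`), lower bounds
  `a ≤ ⟨f, σ_kf⟩ ↔ ∀ A, Q_kA = 0 → a ≤ ‖∂A − Q^{e*}_kf‖²_η` (`le_inner_sigmaTorus_iff`);
* §3 **THEOREM 7.1.1 FOR THE TORUS σ_k ⟺ THE CONFIGURATION-SPACE VARIATIONAL BOUND**: for a weight sequence `w_k > 0` (the physical one
  is `w_k = η^d`, η = L^{−k}) and any constant `c₀`, `(∀ k ≤ m+K, ∀ f, c₀‖f‖² ≤ ⟨f, σ_kf⟩) ↔ (∀ k ≤ m+K, ∀ f, ∀ A with Q_kA = 0, c₀‖f‖² ≤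
  ‖∂A − Q^{e*}_kf‖²_{w_k})` (`thm711_sigmaTorus_iff_variational`; one direction each `thm711_sigmaTorus_of_variational` /
  `variational_of_thm711_sigmaTorus`), and the per-torus instance with a k-DEPENDENT constant from gen 2's `sigmaTorus_coercive`
  (`variational_coercive`).
HONEST SCOPE.  The uniform constant of Theorem 7.1.1 is NOT produced here: it is the fibrewise estimate (7.1.22) (seat p10's
`BIJ85Thm711Fibrewise`/`BIJ85Thm711ClosedCube` on the model symbol, seat p27's `BIJ85Eq7112FibreEnergy` for the fibre split on the `Tor`
carriers); the transport of `∂`, `Q_k`, `Q^{e*}_k` between the `Setup` carriers used here and p27's `Tor` carriers is not in this file.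
Unit `lit-balaban-p33` (literature-prover-lit-balaban-p33-g4-0), 2026-08-21.
-/

open scoped BigOperators RealInnerProductSpace

namespace Literature.MathematicalPhysics.QuantumFieldTheory.BalabanImbrieJaffe1984to88.BIJ85SigmaVariational

open BIJ85AxialPropagator411 BIJ85AxialMinimizer413 BIJ85SigmaForm421 BIJ85Sigma421Torus BIJ85NoZeroModes309Torus
  BIJ85NoZeroModes309TorusPart2 BIJ85SigmaGaugeInvariance BIJ85SigmaPositivity

/-! ## 1. Abstract: `⟨f, σ_kf⟩` is the minimum of the exponent of (4.2.1) over the constraint subspace -/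

section Abstract

variable {E F F' : Type*} [NormedAddCommGroup E] [InnerProductSpace ℝ E] [FiniteDimensional ℝ E]
  [NormedAddCommGroup F] [InnerProductSpace ℝ F] [FiniteDimensional ℝ F]
  [NormedAddCommGroup F'] [InnerProductSpace ℝ F'] [FiniteDimensional ℝ F']

/-- `I − ∂G_{k,Ax}∂^*` kills... rather: `g − ∂G_{k,Ax}∂^*g` is ORTHOGONAL to every curl of a constraint field (p. 311: *"∂G_{k,Ax}∂^* is a
projection operator"* — the orthogonal projection onto `∂V`). [cite: BalabanImbrieJaffe1985, §4.2 p.311] -/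
theorem inner_sub_curlG_curl {V : Submodule ℝ E} {D : E →ₗ[ℝ] F} (hD : ∀ v : V, D (v : E) = 0 → v = 0) (g : F) (u : V) :
    ⟪g - curlG V D g, D (u : E)⟫ = 0 := by
  rw [inner_sub_left, curlG_symm hD, curlG_apply_curl hD u, sub_self]

/-- **Pythagoras for the projection `∂G_{k,Ax}∂^*`**: `‖g − ∂v‖² = ‖g − ∂G_{k,Ax}∂^*g‖² + ‖∂G_{k,Ax}∂^*g − ∂v‖²` for every constraint
field `v ∈ V`. [cite: BalabanImbrieJaffe1985, §4.2 p.311] -/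
theorem norm_sub_curl_sq {V : Submodule ℝ E} {D : E →ₗ[ℝ] F} (hD : ∀ v : V, D (v : E) = 0 → v = 0) (g : F) (v : V) :
    ‖g - D (v : E)‖ ^ 2 = ‖g - curlG V D g‖ ^ 2 + ‖curlG V D g - D (v : E)‖ ^ 2 := by
  obtain ⟨v', hv'⟩ := curlG_mem_range V D g
  have horth : ⟪g - curlG V D g, curlG V D g - D (v : E)⟫ = 0 := by
    have h := inner_sub_curlG_curl hD g (v' - v)
    rwa [Submodule.coe_sub, map_sub, ← hv'] at h
  have hsplit : g - D (v : E) = (g - curlG V D g) + (curlG V D g - D (v : E)) := by abel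
  rw [hsplit, norm_add_sq_real, horth, mul_zero, add_zero]

/-- **The exponent of (4.2.1) splits**: `‖∂v − Q^{e*}_kf‖² = ⟨f, σ_kf⟩ + ‖∂G_{k,Ax}∂^*Q^{e*}_kf − ∂v‖²` for every `v ∈ V` (p09's
`⟨f, σ_kf⟩ = ‖(I − ∂G_{k,Ax}∂^*)Q^{e*}_kf‖²` + Pythagoras). [cite: BalabanImbrieJaffe1985, (4.2.1)–(4.2.2) p.310] -/
theorem energy_eq {V : Submodule ℝ E} {D : E →ₗ[ℝ] F} (hD : ∀ v : V, D (v : E) = 0 → v = 0) (Qes : F' →ₗ[ℝ] F) (f : F')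
    (v : V) : ‖D (v : E) - Qes f‖ ^ 2 = ⟪f, sigmaOp V D Qes f⟫ + ‖curlG V D (Qes f) - D (v : E)‖ ^ 2 := by
  rw [norm_sub_rev, norm_sub_curl_sq hD, inner_sigmaOp_eq_norm_sq hD]

/-- **`⟨f, σ_kf⟩ ≤ ‖∂v − Q^{e*}_kf‖²` for every constraint field `v`** — the exponent of (4.2.1) is bounded below by the form it
defines. [cite: BalabanImbrieJaffe1985, (4.2.1) p.310] -/
theorem inner_sigmaOp_le_energy {V : Submodule ℝ E} {D : E →ₗ[ℝ] F} (hD : ∀ v : V, D (v : E) = 0 → v = 0) (Qes : F' →ₗ[ℝ] F)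
    (f : F') (v : V) : ⟪f, sigmaOp V D Qes f⟫ ≤ ‖D (v : E) - Qes f‖ ^ 2 := by
  rw [energy_eq hD Qes f v]
  exact le_add_of_nonneg_right (sq_nonneg _)

/-- **… with equality attained**: some constraint field realises `‖∂v − Q^{e*}_kf‖² = ⟨f, σ_kf⟩` (namely any `v` with `∂v =
∂G_{k,Ax}∂^*Q^{e*}_kf`, e.g. `v = G_{k,Ax}∂^*Q^{e*}_kf`). [cite: BalabanImbrieJaffe1985, (4.2.1) p.310] -/
theorem exists_energy_eq_inner_sigmaOp {V : Submodule ℝ E} {D : E →ₗ[ℝ] F} (hD : ∀ v : V, D (v : E) = 0 → v = 0)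
    (Qes : F' →ₗ[ℝ] F) (f : F') : ∃ v : V, ‖D (v : E) - Qes f‖ ^ 2 = ⟪f, sigmaOp V D Qes f⟫ := by
  obtain ⟨v, hv⟩ := curlG_mem_range V D (Qes f)
  refine ⟨v, ?_⟩
  rw [energy_eq hD Qes f v, hv, sub_self, norm_zero, zero_pow two_ne_zero, add_zero]

/-- **`⟨f, σ_kf⟩ = inf_{v ∈ V} ‖∂v − Q^{e*}_kf‖²`** — the variational content of (4.2.6)–(4.2.7) (`⟨f, σ_kf⟩ = ‖f_k‖²`, `f_k` the
component of `Q^{e*}_kf` orthogonal to `∂V`, p. 311 *"∂G_{k,Ax}∂^* is a projection operator"*) for p09's operator (4.2.2), abstractly.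
[cite: BalabanImbrieJaffe1985, (4.2.7) p.310] -/
theorem inner_sigmaOp_eq_iInf {V : Submodule ℝ E} {D : E →ₗ[ℝ] F} (hD : ∀ v : V, D (v : E) = 0 → v = 0) (Qes : F' →ₗ[ℝ] F)
    (f : F') : ⟪f, sigmaOp V D Qes f⟫ = ⨅ v : V, ‖D (v : E) - Qes f‖ ^ 2 := by
  apply le_antisymm
  · exact le_ciInf fun v => inner_sigmaOp_le_energy hD Qes f v
  · obtain ⟨v, hv⟩ := exists_energy_eq_inner_sigmaOp hD Qes f
    rw [← hv]
    exact ciInf_le ⟨0, by rintro _ ⟨u, rfl⟩; positivity⟩ v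

/-- **Transfer of lower bounds**: `a ≤ ⟨f, σ_kf⟩` iff `a ≤ ‖∂v − Q^{e*}_kf‖²` for every constraint field `v` — how a bound on the
variational problem becomes the bound (4.2.3)/(7.1.1) on σ_k, and conversely. [cite: BalabanImbrieJaffe1985, (4.2.3) p.310] -/
theorem le_inner_sigmaOp_iff {V : Submodule ℝ E} {D : E →ₗ[ℝ] F} (hD : ∀ v : V, D (v : E) = 0 → v = 0) (Qes : F' →ₗ[ℝ] F)
    (f : F') (a : ℝ) : a ≤ ⟪f, sigmaOp V D Qes f⟫ ↔ ∀ v : V, a ≤ ‖D (v : E) - Qes f‖ ^ 2 := by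
  refine ⟨fun h v => h.trans (inner_sigmaOp_le_energy hD Qes f v), fun h => ?_⟩
  obtain ⟨v, hv⟩ := exists_energy_eq_inner_sigmaOp hD Qes f
  rw [← hv]
  exact h v

end Abstract

/-! ## 2. On the tori: the axial-gauge factor `δ_{k,Ax}` removed from the infimum -/

section Torus

open Literature.MathematicalPhysics.QuantumFieldTheory.Balaban1983to89
open LatticeFieldCalculus BIJ85Eq531Inputs

variable {P : Params}

/-- **The exponent of (4.2.1) on the torus, printed form**: `‖√w·∂A − √w·Q^{e*}_kf‖² = Σ_pη^d|(∂A)(p) − (Q^{e*}_kf)(p)|²` for an η-bond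
field `A` (p30's `norm_sq_curlOp_sub_QesOp`; `w = η^d ≥ 0`). [cite: BalabanImbrieJaffe1985, (4.2.1) p.310] -/
theorem energy_eq_sum (hd : 2 ≤ P.d) {w : ℝ} (hw : 0 ≤ w) (c : ℝ) (k : ℕ) (A : VecField P 0 ℝ) (f : UnitPlaqSpace P k) :
    ‖curlOp (P := P) w c (toE P A) - QesOp (P := P) hd w k f‖ ^ 2 =
      ∑ p : Plaq P 0, w * (curl c A p - QestarIter hd k (fun q => f q) p) ^ 2 := by
  rw [norm_sq_curlOp_sub_QesOp hd hw c k, LinearEquiv.symm_apply_apply]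

/-- **`δ_{k,Ax}` does not raise the infimum**: `⟨f, σ_kf⟩ ≤ ‖√w·∂A − √w·Q^{e*}_kf‖²` for EVERY η-bond field `A` with `Q_kA = 0` — axial or
not: by gen 3's `exists_mem_V411_curlOp_eq` (*"the gauge chosen to define σ_k is irrelevant"*: a restricted gauge transformation
`λ ∈ N(Q′_k)` carries `A` into `δ(Q_kA)δ_{k,Ax}` without changing `∂A`), then §1; standing range, `w > 0`, `c ≠ 0`.
[cite: BalabanImbrieJaffe1985, (4.2.1)–(4.2.2) p.310] -/
theorem inner_sigmaTorus_le_energy (hd : 2 ≤ P.d) {k : ℕ} (hk : k ≤ P.m + P.K) {w : ℝ} (hw : 0 < w) {c : ℝ} (hc : c ≠ 0)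
    (f : UnitPlaqSpace P k) (A : VecField P 0 ℝ) (hQ : bondAvgIter k A = 0) :
    ⟪f, sigmaTorus (P := P) hd w c k f⟫ ≤ ‖curlOp (P := P) w c (toE P A) - QesOp (P := P) hd w k f‖ ^ 2 := by
  obtain ⟨v, hv, hcurl⟩ := exists_mem_V411_curlOp_eq hk hc w A hQ
  have h := inner_sigmaOp_le_energy (noZeroModes_V411_holds hk hw hc) (QesOp (P := P) hd w k) f ⟨v, hv⟩
  rw [Submodule.coe_mk, hcurl] at h
  exact h

/-- The same in the printed η-lattice form: `⟨f, σ_kf⟩ ≤ Σ_pη^d|(∂A)(p) − (Q^{e*}_kf)(p)|²` whenever `Q_kA = 0`.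
[cite: BalabanImbrieJaffe1985, (4.2.1) p.310] -/
theorem inner_sigmaTorus_le_energy_sum (hd : 2 ≤ P.d) {k : ℕ} (hk : k ≤ P.m + P.K) {w : ℝ} (hw : 0 < w) {c : ℝ} (hc : c ≠ 0)
    (f : UnitPlaqSpace P k) (A : VecField P 0 ℝ) (hQ : bondAvgIter k A = 0) :
    ⟪f, sigmaTorus (P := P) hd w c k f⟫ ≤ ∑ p : Plaq P 0, w * (curl c A p - QestarIter hd k (fun q => f q) p) ^ 2 := by
  rw [← energy_eq_sum hd hw.le c k A f]
  exact inner_sigmaTorus_le_energy hd hk hw hc f A hQ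

/-- **The infimum is attained inside `δ(Q_kA)δ_{k,Ax}(A)`**: some η-bond field with `Q_kA = 0` in the k-axial gauge realises
`‖√w·∂A − √w·Q^{e*}_kf‖² = ⟨f, σ_kf⟩` (standing range, `w > 0`, `c ≠ 0`). [cite: BalabanImbrieJaffe1985, (4.2.1) p.310] -/
theorem exists_energy_eq_inner_sigmaTorus (hd : 2 ≤ P.d) {k : ℕ} (hk : k ≤ P.m + P.K) {w : ℝ} (hw : 0 < w) {c : ℝ}
    (hc : c ≠ 0) (f : UnitPlaqSpace P k) :
    ∃ A : VecField P 0 ℝ, bondAvgIter k A = 0 ∧ deltaAx k A ∧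
      ‖curlOp (P := P) w c (toE P A) - QesOp (P := P) hd w k f‖ ^ 2 = ⟪f, sigmaTorus (P := P) hd w c k f⟫ := by
  obtain ⟨v, hv⟩ := exists_energy_eq_inner_sigmaOp (noZeroModes_V411_holds hk hw hc) (QesOp (P := P) hd w k) f
  have hmem := (mem_V411 k (v : BondSpace P)).1 v.2
  refine ⟨(toE P).symm (v : BondSpace P), hmem.1, hmem.2, ?_⟩
  rw [LinearEquiv.apply_symm_apply]
  exact hv

/-- **`⟨f, σ_kf⟩ = inf_{Q_kA = 0} ‖∂A − Q^{e*}_kf‖²_η` on the torus — WITHOUT the axial gauge condition** (gauge invariance, p. 322;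
standing range, `w > 0`, `c ≠ 0`). [cite: BalabanImbrieJaffe1985, (7.1.12) p.322] -/
theorem inner_sigmaTorus_eq_iInf (hd : 2 ≤ P.d) {k : ℕ} (hk : k ≤ P.m + P.K) {w : ℝ} (hw : 0 < w) {c : ℝ} (hc : c ≠ 0)
    (f : UnitPlaqSpace P k) :
    ⟪f, sigmaTorus (P := P) hd w c k f⟫ =
      ⨅ A : {A : VecField P 0 ℝ // bondAvgIter k A = 0},
        ‖curlOp (P := P) w c (toE P A.1) - QesOp (P := P) hd w k f‖ ^ 2 := by
  haveI : Nonempty {A : VecField P 0 ℝ // bondAvgIter k A = 0} := ⟨⟨0, bondAvgIter_map_zero k⟩⟩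
  apply le_antisymm
  · exact le_ciInf fun A => inner_sigmaTorus_le_energy hd hk hw hc f A.1 A.2
  · obtain ⟨A, hQ, -, hE⟩ := exists_energy_eq_inner_sigmaTorus hd hk hw hc f
    have hbdd : BddBelow (Set.range fun B : {A : VecField P 0 ℝ // bondAvgIter k A = 0} =>
        ‖curlOp (P := P) w c (toE P B.1) - QesOp (P := P) hd w k f‖ ^ 2) := ⟨0, by rintro _ ⟨B, rfl⟩; exact sq_nonneg _⟩
    exact (ciInf_le hbdd ⟨A, hQ⟩).trans_eq hE

/-- **… and `= inf_{Q_kA=0, δ_{k,Ax}(A)} ‖∂A − Q^{e*}_kf‖²_η`** — the infimum over the support of `δ(Q_kA)δ_{k,Ax}(A)` of (4.2.1) (the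
two infima agree). [cite: BalabanImbrieJaffe1985, (4.2.7) p.310] -/
theorem inner_sigmaTorus_eq_iInf_axial (hd : 2 ≤ P.d) {k : ℕ} (hk : k ≤ P.m + P.K) {w : ℝ} (hw : 0 < w) {c : ℝ} (hc : c ≠ 0)
    (f : UnitPlaqSpace P k) :
    ⟪f, sigmaTorus (P := P) hd w c k f⟫ =
      ⨅ A : {A : VecField P 0 ℝ // bondAvgIter k A = 0 ∧ deltaAx k A},
        ‖curlOp (P := P) w c (toE P A.1) - QesOp (P := P) hd w k f‖ ^ 2 := by
  haveI : Nonempty {A : VecField P 0 ℝ // bondAvgIter k A = 0 ∧ deltaAx k A} :=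
    ⟨⟨0, (mem_constraint411 k (0 : VecField P 0 ℝ)).1 (Submodule.zero_mem _)⟩⟩
  apply le_antisymm
  · exact le_ciInf fun A => inner_sigmaTorus_le_energy hd hk hw hc f A.1 A.2.1
  · obtain ⟨A, hQ, hAx, hE⟩ := exists_energy_eq_inner_sigmaTorus hd hk hw hc f
    have hbdd : BddBelow (Set.range fun B : {A : VecField P 0 ℝ // bondAvgIter k A = 0 ∧ deltaAx k A} =>
        ‖curlOp (P := P) w c (toE P B.1) - QesOp (P := P) hd w k f‖ ^ 2) := ⟨0, by rintro _ ⟨B, rfl⟩; exact sq_nonneg _⟩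
    exact (ciInf_le hbdd ⟨A, ⟨hQ, hAx⟩⟩).trans_eq hE

/-- **Transfer of lower bounds on the torus**: `a ≤ ⟨f, σ_kf⟩` iff `a ≤ ‖√w·∂A − √w·Q^{e*}_kf‖²` for every `A` with `Q_kA = 0`.
[cite: BalabanImbrieJaffe1985, (4.2.3) p.310] -/
theorem le_inner_sigmaTorus_iff (hd : 2 ≤ P.d) {k : ℕ} (hk : k ≤ P.m + P.K) {w : ℝ} (hw : 0 < w) {c : ℝ} (hc : c ≠ 0)
    (f : UnitPlaqSpace P k) (a : ℝ) :
    a ≤ ⟪f, sigmaTorus (P := P) hd w c k f⟫ ↔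
      ∀ A : VecField P 0 ℝ, bondAvgIter k A = 0 → a ≤ ‖curlOp (P := P) w c (toE P A) - QesOp (P := P) hd w k f‖ ^ 2 := by
  refine ⟨fun h A hQ => h.trans (inner_sigmaTorus_le_energy hd hk hw hc f A hQ), fun h => ?_⟩
  obtain ⟨A, hQ, -, hE⟩ := exists_energy_eq_inner_sigmaTorus hd hk hw hc f
  rw [← hE]
  exact h A hQ

/-! ## 3. Theorem 7.1.1 for the torus σ_k ⟺ the configuration-space variational bound -/

/-- **Thm 7.1.1 for the torus σ_k FROM the variational bound**: if for every `k ≤ m + K`, every unit-lattice plaquette field `f` and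
every η-bond field `A` with `Q_kA = 0` one has `c₀‖f‖² ≤ ‖√w_k·∂A − √w_k·Q^{e*}_kf‖²` (the configuration-space form of (7.1.1) targeted by
seat p27's fibre decomposition), then `c₀‖f‖² ≤ ⟨f, σ_kf⟩` for all these k and f (`w_k > 0` any weights — the physical ones are
`w_k = η^d`, η = L^{−k}; `c ≠ 0`). [cite: BalabanImbrieJaffe1985, Theorem 7.1.1 p.321] -/
theorem thm711_sigmaTorus_of_variational (hd : 2 ≤ P.d) (w : ℕ → ℝ) (hw : ∀ k, 0 < w k) {c : ℝ} (hc : c ≠ 0) {c₀ : ℝ}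
    (h : ∀ k, k ≤ P.m + P.K → ∀ (f : UnitPlaqSpace P k) (A : VecField P 0 ℝ), bondAvgIter k A = 0 →
      c₀ * ‖f‖ ^ 2 ≤ ‖curlOp (P := P) (w k) c (toE P A) - QesOp (P := P) hd (w k) k f‖ ^ 2) :
    ∀ k, k ≤ P.m + P.K → ∀ f : UnitPlaqSpace P k, c₀ * ‖f‖ ^ 2 ≤ ⟪f, sigmaTorus (P := P) hd (w k) c k f⟫ :=
  fun k hk f => (le_inner_sigmaTorus_iff hd hk (hw k) hc f _).2 (h k hk f)

/-- **… and conversely**: the bound (7.1.1) for the torus σ_k gives the configuration-space variational bound over `{Q_kA = 0}`.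
[cite: BalabanImbrieJaffe1985, Theorem 7.1.1 p.321] -/
theorem variational_of_thm711_sigmaTorus (hd : 2 ≤ P.d) (w : ℕ → ℝ) (hw : ∀ k, 0 < w k) {c : ℝ} (hc : c ≠ 0) {c₀ : ℝ}
    (h : ∀ k, k ≤ P.m + P.K → ∀ f : UnitPlaqSpace P k, c₀ * ‖f‖ ^ 2 ≤ ⟪f, sigmaTorus (P := P) hd (w k) c k f⟫) :
    ∀ k, k ≤ P.m + P.K → ∀ (f : UnitPlaqSpace P k) (A : VecField P 0 ℝ), bondAvgIter k A = 0 →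
      c₀ * ‖f‖ ^ 2 ≤ ‖curlOp (P := P) (w k) c (toE P A) - QesOp (P := P) hd (w k) k f‖ ^ 2 :=
  fun k hk f => (le_inner_sigmaTorus_iff hd hk (hw k) hc f _).1 (h k hk f)

/-- **THEOREM 7.1.1 FOR THE TORUS σ_k ⟺ THE VARIATIONAL BOUND** (both with the same constant, uniformly in `k ≤ m + K`): *"There
exists a constant c > 0, independent of k, such that c ≤ σ_k (7.1.1)"* holds for `sigmaTorus hd (w k) c k` in form sense iff
`c‖f‖² ≤ ‖∂A − Q^{e*}_kf‖²_{w_k}` for all `k ≤ m + K`, `f`, and `A` with `Q_kA = 0`. [cite: BalabanImbrieJaffe1985, Theorem 7.1.1 p.321] -/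
theorem thm711_sigmaTorus_iff_variational (hd : 2 ≤ P.d) (w : ℕ → ℝ) (hw : ∀ k, 0 < w k) {c : ℝ} (hc : c ≠ 0) (c₀ : ℝ) :
    (∀ k, k ≤ P.m + P.K → ∀ f : UnitPlaqSpace P k, c₀ * ‖f‖ ^ 2 ≤ ⟪f, sigmaTorus (P := P) hd (w k) c k f⟫) ↔
      ∀ k, k ≤ P.m + P.K → ∀ (f : UnitPlaqSpace P k) (A : VecField P 0 ℝ), bondAvgIter k A = 0 →
        c₀ * ‖f‖ ^ 2 ≤ ‖curlOp (P := P) (w k) c (toE P A) - QesOp (P := P) hd (w k) k f‖ ^ 2 :=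
  ⟨variational_of_thm711_sigmaTorus hd w hw hc, thm711_sigmaTorus_of_variational hd w hw hc⟩

/-- **The variational bound on ONE torus with a k-dependent constant** (gen 2's `sigmaTorus_coercive` transferred): `∃ c_k > 0`, `c_k‖f‖² ≤
‖√w·∂A − √w·Q^{e*}_kf‖²` for all `f` and all `A` with `Q_kA = 0`.  SCOPE: the constant depends on the torus and on k; the UNIFORM
constant is Theorem 7.1.1 and is not claimed. [cite: BalabanImbrieJaffe1985, (4.2.3) p.310] -/
theorem variational_coercive (hd : 2 ≤ P.d) {k : ℕ} (hk : k ≤ P.m + P.K) {w : ℝ} (hw : 0 < w) {c : ℝ} (hc : c ≠ 0) :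
    ∃ c₀ : ℝ, 0 < c₀ ∧ ∀ (f : UnitPlaqSpace P k) (A : VecField P 0 ℝ), bondAvgIter k A = 0 →
      c₀ * ‖f‖ ^ 2 ≤ ‖curlOp (P := P) w c (toE P A) - QesOp (P := P) hd w k f‖ ^ 2 := by
  obtain ⟨c₀, hc₀, h⟩ := sigmaTorus_coercive hd hk hw hc
  exact ⟨c₀, hc₀, fun f A hQ => (h f).trans (inner_sigmaTorus_le_energy hd hk hw hc f A hQ)⟩

end Torus

end Literature.MathematicalPhysics.QuantumFieldTheory.BalabanImbrieJaffe1984to88.BIJ85SigmaVariational
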